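import Mathlib.Analysis.Complex.ExponentialBounds
import Literature.NumberTheory.LFunctions.RieszCriterionProofs
import HarnessLib

/-!
# RH-EQUIVALENT (one half PROVED) · Báez-Duarte's sequential criterion `BaezDuarte2005_thm_1_1`: the direction "`c_k ≪ k^{−3/4+ε}` for every `ε > 0` ⟹ RH" PROVED, by Poissonisation `F(x) = x e^{−x} Σ_k c_k x^k/k!` onto Riesz's criterion — nothing here bears on the truth of RH

Literature-typing tranche `rh-lit-broughan-2` (Broughan, *Equivalents of the Riemann Hypothesis*,
Vol. 2, Ch. 2 "Series Equivalents" / §2.6 "Further Work"). The typed named fact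
`BaezDuarte2005_thm_1_1` (file `RieszTypeSeriesCriteria`) reads
`RiemannHypothesis ↔ ∀ ε > 0, c_k = O(k^{−3/4+ε})`, with Báez-Duarte's coefficients
`c_k = Σ_{j≤k} (−1)^j (k choose j)/ζ(2j+2)` (`baezDuarteCoeff`). This file PROVES the direction
"⟸" (sufficiency). Báez-Duarte's own proof of sufficiency [BaezDuarte2005, §2, Prop. 2.1] expands
`1/ζ(s) = Σ_k c_k P_k(s/2)` in Pochhammer polynomials and needs their asymptotics (his Lemma 1.1,
stated without proof); here a shorter road is taken (a deviation, recorded as such): the binomial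
transform defining `c_k` is undone by the exponential generating function,
`Σ_k c_k x^k/k! = e^x · Σ_j (−1)^j x^j/(j! ζ(2j+2)) = e^x F(x)/x` (Cauchy product with `e^x`),
where `F` is Riesz's function; a Poisson-weight estimate turns `c_k ≪ k^{−a}` (`0 ≤ a`) into
`F(x) ≪ x^{1−a}`, and Riesz's sufficiency theorem `riemannHypothesis_of_rieszFunction_isBigO`
(file `RieszCriterionProofs`, Titchmarsh §14.32) concludes.

* `rieszFunction_eq_exp_mul_tsum_baezDuarteCoeff` — `F(x) = x e^{−x} Σ_k c_k x^k/k!`.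
* `poisson_weight_le` — `k^{−a} x^k/k! ≤ 2^{x/2}(x/2)^k/k! + (x/2)^{−a} x^k/k!`
  (`k ≥ 1`, `a ≥ 0`, `x > 0`).
* `rieszFunction_isBigO_of_baezDuarteCoeff_isBigO` — `c_k = O(k^{−a})` ⟹ `F(x) = O(x^{1−a})`.
* `riemannHypothesis_of_baezDuarteCoeff_isBigO`, `BaezDuarte2005_thm_1_1.mpr_holds`.

No new definitions, no new facts (D-0026); standard axioms only.

## References

* [BaezDuarte2005] L. Báez-Duarte, *A sequential Riesz-like criterion for the Riemann hypothesis*,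
  Int. J. Math. Math. Sci. 2005:21, 3527–3537 (arXiv:math/0307215), Thm. 1.1, §2
  [corpus: paper:arxiv-math_0307215 p. 4].
* [Titchmarsh1986] E. C. Titchmarsh, *The Theory of the Riemann Zeta-Function*, 2nd ed., §14.32.
* [Broughan2017] K. Broughan, *Equivalents of the Riemann Hypothesis*, Vol. 2, Ch. 2 (secondary).
-/

noncomputable section

open MeasureTheory Set Filter Asymptotics Finset

open scoped Real Topology Nat

namespace Literature.NumberTheory.LFunctions

/-! ## §1 Poissonisation: `F(x) = x e^{−x} Σ_k c_k x^k/k!` -/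

/-- `1 ≤ ζ(x)` for real `x > 1` (private mirror, as in `RieszCriterionProofs`).
[cite: Titchmarsh1986, §14.32 (ζ(2k) ≥ 1 in the majorant of (14.32.1))] -/
private theorem one_le_re_riemannZeta_real'' {x : ℝ} (hx : 1 < x) : 1 ≤ (riemannZeta x).re := by
  have hx' : 1 < (x : ℂ).re := by simpa using hx
  have hsum : Summable fun n : ℕ ↦ 1 / ((n : ℂ) + 1) ^ (x : ℂ) := by
    have := (Complex.summable_one_div_nat_cpow (p := (x : ℂ))).2 hx'
    rw [← summable_nat_add_iff 1] at this
    simpa using this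
  have hterm : ∀ n : ℕ, (1 / ((n : ℂ) + 1) ^ (x : ℂ)) = ((((n : ℝ) + 1) ^ x)⁻¹ : ℝ) := by
    intro n
    have : ((n : ℂ) + 1) = (((n : ℝ) + 1 : ℝ) : ℂ) := by push_cast; ring
    rw [this, ← Complex.ofReal_cpow (by positivity), one_div, Complex.ofReal_inv]
  rw [zeta_eq_tsum_one_div_nat_add_one_cpow hx', Complex.re_tsum hsum]
  simp_rw [hterm, Complex.ofReal_re]
  have hsum' : Summable fun n : ℕ ↦ (((n : ℝ) + 1) ^ x)⁻¹ := by
    have := Complex.reCLM.summable hsum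
    refine this.congr fun n ↦ ?_
    simp only [Complex.reCLM_apply, hterm, Complex.ofReal_re]
  calc (1 : ℝ) = ((((0 : ℕ) : ℝ) + 1) ^ x)⁻¹ := by simp
    _ ≤ ∑' n : ℕ, (((n : ℝ) + 1) ^ x)⁻¹ := hsum'.le_tsum 0 (fun j _ ↦ by positivity)

/-- The exponential generating function of Báez-Duarte's coefficients:
`Σ_k c_k x^k/k! = e^x · Σ_j (−1)^j x^j/(j! ζ(2j+2))` (Cauchy product of the two absolutely
convergent series, `c_k` being the binomial transform of `((−1)^j/ζ(2j+2))_j`), as a `HasSum`.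
[cite: BaezDuarte2005, eq. (1.1) (definition of c_k as a binomial transform)] -/
theorem hasSum_baezDuarteCoeff_mul_pow_div_factorial (x : ℝ) :
    HasSum (fun k : ℕ ↦ baezDuarteCoeff k * x ^ k / k !)
      (Real.exp x * ∑' j : ℕ, (-1) ^ j * x ^ j / ((j ! : ℝ) * (riemannZeta (2 * j + 2 : ℝ)).re)) := by
  -- the two series: `a_j = (−1)^j x^j/(j! ζ(2j+2))`, `b_m = x^m/m!`
  set a : ℕ → ℝ := fun j ↦ (-1) ^ j * x ^ j / ((j ! : ℝ) * (riemannZeta (2 * j + 2 : ℝ)).re)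
    with ha
  set b : ℕ → ℝ := fun m ↦ x ^ m / m ! with hb
  have hζ : ∀ j : ℕ, 1 ≤ (riemannZeta (2 * j + 2 : ℝ)).re := fun j ↦
    one_le_re_riemannZeta_real'' (by have : (0 : ℝ) ≤ j := j.cast_nonneg; linarith)
  have hζpos : ∀ j : ℕ, 0 < (riemannZeta (2 * j + 2 : ℝ)).re := fun j ↦
    lt_of_lt_of_le one_pos (hζ j)
  have ha_norm : Summable fun j ↦ ‖a j‖ := by
    refine Summable.of_nonneg_of_le (fun j ↦ norm_nonneg _) (fun j ↦ ?_)
      (Real.summable_pow_div_factorial |x|)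
    rw [ha, Real.norm_eq_abs, abs_div, abs_mul, abs_pow, abs_pow, abs_neg, abs_one, one_pow,
      one_mul, abs_of_pos (mul_pos (by positivity) (hζpos j))]
    exact div_le_div_of_nonneg_left (by positivity) (by positivity)
      (le_mul_of_one_le_right (by positivity) (hζ j))
  have hb_norm : Summable fun m ↦ ‖b m‖ := by
    refine (Real.summable_pow_div_factorial |x|).congr fun m ↦ ?_
    rw [hb, Real.norm_eq_abs, abs_div, abs_pow, Nat.abs_cast]
  have hb_sum : ∑' m, b m = Real.exp x := by
    have h := NormedSpace.expSeries_div_hasSum_exp x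
    rw [← congrFun Real.exp_eq_exp_ℝ x] at h
    exact h.tsum_eq
  -- Cauchy product
  have hprod := tsum_mul_tsum_eq_tsum_sum_range_of_summable_norm ha_norm hb_norm
  have hinner : ∀ k : ℕ, ∑ j ∈ range (k + 1), a j * b (k - j) = baezDuarteCoeff k * x ^ k / k ! := by
    intro k
    rw [baezDuarteCoeff, Finset.sum_mul, Finset.sum_div]
    refine Finset.sum_congr rfl fun j hj ↦ ?_
    have hjk : j ≤ k := Nat.lt_succ_iff.1 (Finset.mem_range.1 hj)
    rw [ha, hb, Nat.cast_choose ℝ hjk]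
    have hj : (j ! : ℝ) ≠ 0 := by positivity
    have hkj : ((k - j)! : ℝ) ≠ 0 := by positivity
    have hk : (k ! : ℝ) ≠ 0 := by positivity
    have hz : (riemannZeta (2 * j + 2 : ℝ)).re ≠ 0 := (hζpos j).ne'
    rw [show x ^ k = x ^ j * x ^ (k - j) by rw [← pow_add, Nat.add_sub_cancel' hjk]]
    field_simp
  have hsumm : Summable fun k : ℕ ↦ ∑ j ∈ range (k + 1), a j * b (k - j) :=
    (summable_norm_sum_mul_range_of_summable_norm ha_norm hb_norm).of_norm
  rw [hb_sum, mul_comm] at hprod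
  simp_rw [hinner] at hprod hsumm
  rw [show Real.exp x * tsum a = ∑' k : ℕ, baezDuarteCoeff k * x ^ k / k ! from hprod]
  exact hsumm.hasSum

/-- **Poissonisation of Riesz's function:** `F(x) = x e^{−x} Σ_k c_k x^k/k!` for every real `x`.
[cite: BaezDuarte2005, eq. (1.1); Titchmarsh1986, §14.32 (14.32.1)] -/
theorem rieszFunction_eq_exp_mul_tsum_baezDuarteCoeff (x : ℝ) :
    rieszFunction x = x * Real.exp (-x) * ∑' k : ℕ, baezDuarteCoeff k * x ^ k / k ! := by
  rw [(hasSum_baezDuarteCoeff_mul_pow_div_factorial x).tsum_eq, rieszFunction, ← tsum_mul_left,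
    ← tsum_mul_left]
  refine tsum_congr fun j ↦ ?_
  rw [Real.exp_neg]
  have he : Real.exp x ≠ 0 := (Real.exp_pos x).ne'
  field_simp
  ring

/-! ## §2 From `c_k ≪ k^{−a}` to `F(x) ≪ x^{1−a}` -/

/-- Poisson-weight bound: for `k ≥ 1`, `a ≥ 0`, `x > 0`,
`k^{−a} x^k/k! ≤ 2^{x/2} (x/2)^k/k! + (x/2)^{−a} x^k/k!` (split at `k ≤ x/2`: there `x^k ≤ 2^{x/2}(x/2)^k`;
beyond, `k^{−a} ≤ (x/2)^{−a}`). [cite: BaezDuarte2005, Thm. 1.1 (sufficiency; our Poissonisation route)] -/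
theorem poisson_weight_le {a x : ℝ} (ha : 0 ≤ a) (hx : 0 < x) {k : ℕ} (hk : 1 ≤ k) :
    (k : ℝ) ^ (-a) * (x ^ k / k !) ≤
      (2 : ℝ) ^ (x / 2) * ((x / 2) ^ k / k !) + (x / 2) ^ (-a) * (x ^ k / k !) := by
  have h1 : 0 ≤ (2 : ℝ) ^ (x / 2) * ((x / 2) ^ k / k !) := by positivity
  have h2 : 0 ≤ (x / 2) ^ (-a) * (x ^ k / k !) := by positivity
  rcases le_or_gt (k : ℝ) (x / 2) with hle | hlt
  · have hka : (k : ℝ) ^ (-a) ≤ 1 :=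
      Real.rpow_le_one_of_one_le_of_nonpos (by exact_mod_cast hk) (by linarith)
    have hpow : x ^ k = (2 : ℝ) ^ (k : ℝ) * (x / 2) ^ k := by
      rw [Real.rpow_natCast, ← mul_pow]
      congr 1
      ring
    have h2k : (2 : ℝ) ^ (k : ℝ) ≤ (2 : ℝ) ^ (x / 2) :=
      Real.rpow_le_rpow_of_exponent_le one_le_two hle
    calc (k : ℝ) ^ (-a) * (x ^ k / k !) ≤ 1 * (x ^ k / k !) := by gcongr
      _ = (2 : ℝ) ^ (k : ℝ) * ((x / 2) ^ k / k !) := by rw [one_mul, hpow, mul_div_assoc]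
      _ ≤ (2 : ℝ) ^ (x / 2) * ((x / 2) ^ k / k !) := by gcongr
      _ ≤ _ := le_add_of_nonneg_right h2
  · have hka : (k : ℝ) ^ (-a) ≤ (x / 2) ^ (-a) :=
      Real.rpow_le_rpow_of_nonpos (by positivity) hlt.le (by linarith)
    calc (k : ℝ) ^ (-a) * (x ^ k / k !) ≤ (x / 2) ^ (-a) * (x ^ k / k !) := by gcongr
      _ ≤ _ := le_add_of_nonneg_left h1

/-- **Transfer:** if `c_k = O(k^{−a})` (`0 ≤ a ≤ 1`) then `F(x) = O(x^{1−a})` as `x → +∞`, via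
`F(x) = x e^{−x} Σ c_k x^k/k!` and `poisson_weight_le`:
`|F(x)| ≤ C (x 2^{x/2} e^{−x/2} + 2^a x^{1−a})`. [cite: BaezDuarte2005, Thm. 1.1 (sufficiency); Titchmarsh1986, §14.32] -/
theorem rieszFunction_isBigO_of_baezDuarteCoeff_isBigO {a : ℝ} (ha : 0 ≤ a) (ha1 : a ≤ 1)
    (h : (fun k : ℕ ↦ baezDuarteCoeff k) =O[atTop] fun k : ℕ ↦ (k : ℝ) ^ (-a)) :
    rieszFunction =O[atTop] fun x : ℝ ↦ x ^ (1 - a) := by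
  -- one constant for all `k`: `|c_0| ≤ C` and `|c_k| ≤ C k^{-a}` (`k ≥ 1`)
  obtain ⟨C, hC0, hCz, hCk⟩ : ∃ C : ℝ, 0 ≤ C ∧ |baezDuarteCoeff 0| ≤ C ∧
      ∀ k : ℕ, 1 ≤ k → |baezDuarteCoeff k| ≤ C * (k : ℝ) ^ (-a) := by
    obtain ⟨C₀, hC₀pos, hC₀⟩ := h.exists_pos
    rw [isBigOWith_iff, eventually_atTop] at hC₀
    obtain ⟨N, hN⟩ := hC₀
    set B : ℝ := ∑ j ∈ range N, |baezDuarteCoeff j| * (j : ℝ) ^ a with hB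
    have hBnn : 0 ≤ B := Finset.sum_nonneg fun j _ ↦ by positivity
    refine ⟨C₀ + |baezDuarteCoeff 0| + B, by positivity, by linarith [abs_nonneg (baezDuarteCoeff 0)],
      fun k hk ↦ ?_⟩
    have hk0 : (0 : ℝ) < k := by exact_mod_cast hk
    have hka : 0 ≤ (k : ℝ) ^ (-a) := by positivity
    by_cases hkN : N ≤ k
    · have h1 := hN k hkN
      rw [Real.norm_eq_abs, Real.norm_eq_abs, abs_of_nonneg hka] at h1
      calc |baezDuarteCoeff k| ≤ C₀ * (k : ℝ) ^ (-a) := h1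
        _ ≤ (C₀ + |baezDuarteCoeff 0| + B) * (k : ℝ) ^ (-a) := by
            gcongr; linarith [abs_nonneg (baezDuarteCoeff 0)]
    · have hkN' : k < N := lt_of_not_ge hkN
      have hsingle : |baezDuarteCoeff k| * (k : ℝ) ^ a ≤ B :=
        Finset.single_le_sum (f := fun j ↦ |baezDuarteCoeff j| * (j : ℝ) ^ a)
          (fun j _ ↦ by positivity) (Finset.mem_range.2 hkN')
      have heq : |baezDuarteCoeff k| = |baezDuarteCoeff k| * (k : ℝ) ^ a * (k : ℝ) ^ (-a) := by
        rw [mul_assoc, ← Real.rpow_add hk0, add_neg_cancel, Real.rpow_zero, mul_one]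
      rw [heq]
      gcongr
      linarith [abs_nonneg (baezDuarteCoeff 0)]
  -- the estimate for `x ≥ 1`
  have hlog : Real.log 2 < 1 := by linarith [Real.log_two_lt_d9]
  set c : ℝ := (1 - Real.log 2) / 2 with hc
  have hcpos : 0 < c := by rw [hc]; linarith
  refine IsBigO.of_bound (C * (1 / c) + C * (2 : ℝ) ^ a) ?_
  filter_upwards [eventually_ge_atTop (1 : ℝ)] with x hx
  have hx0 : 0 < x := by linarith
  -- termwise majorant of `Σ |c_k| x^k/k!`
  have hterm : ∀ k : ℕ, ‖baezDuarteCoeff k * x ^ k / (k ! : ℝ)‖ ≤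
      C * ((2 : ℝ) ^ (x / 2) * ((x / 2) ^ k / k !) + (x / 2) ^ (-a) * (x ^ k / k !)) := by
    intro k
    rw [Real.norm_eq_abs, abs_div, abs_mul, abs_pow, abs_of_pos hx0, Nat.abs_cast]
    rcases Nat.eq_zero_or_pos k with rfl | hk
    · simp only [pow_zero, Nat.factorial_zero, Nat.cast_one, div_one, mul_one]
      have h1 : (1 : ℝ) ≤ (2 : ℝ) ^ (x / 2) := Real.one_le_rpow one_le_two (by positivity)
      have h2 : (0 : ℝ) ≤ (x / 2) ^ (-a) := by positivity
      nlinarith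
    · calc |baezDuarteCoeff k| * x ^ k / k ! = |baezDuarteCoeff k| * (x ^ k / k !) := by ring
        _ ≤ C * (k : ℝ) ^ (-a) * (x ^ k / k !) := by gcongr; exact hCk k hk
        _ = C * ((k : ℝ) ^ (-a) * (x ^ k / k !)) := by ring
        _ ≤ C * ((2 : ℝ) ^ (x / 2) * ((x / 2) ^ k / k !) + (x / 2) ^ (-a) * (x ^ k / k !)) := by
            gcongr; exact poisson_weight_le ha hx0 hk
  have hexp : ∀ y : ℝ, HasSum (fun k : ℕ ↦ y ^ k / k !) (Real.exp y) := fun y ↦ by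
    have h := NormedSpace.expSeries_div_hasSum_exp y
    rwa [← congrFun Real.exp_eq_exp_ℝ y] at h
  have hmaj : HasSum (fun k : ℕ ↦ C * ((2 : ℝ) ^ (x / 2) * ((x / 2) ^ k / k !) +
      (x / 2) ^ (-a) * (x ^ k / k !)))
      (C * ((2 : ℝ) ^ (x / 2) * Real.exp (x / 2) + (x / 2) ^ (-a) * Real.exp x)) :=
    (((hexp (x / 2)).mul_left _).add ((hexp x).mul_left _)).mul_left C
  have hsn : Summable fun k : ℕ ↦ ‖baezDuarteCoeff k * x ^ k / (k ! : ℝ)‖ :=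
    Summable.of_nonneg_of_le (fun k ↦ norm_nonneg _) hterm hmaj.summable
  have hS : ‖∑' k : ℕ, baezDuarteCoeff k * x ^ k / (k ! : ℝ)‖ ≤
      C * ((2 : ℝ) ^ (x / 2) * Real.exp (x / 2) + (x / 2) ^ (-a) * Real.exp x) :=
    calc ‖∑' k : ℕ, baezDuarteCoeff k * x ^ k / (k ! : ℝ)‖
        ≤ ∑' k : ℕ, ‖baezDuarteCoeff k * x ^ k / (k ! : ℝ)‖ := norm_tsum_le_tsum_norm hsn
      _ ≤ ∑' k : ℕ, C * ((2 : ℝ) ^ (x / 2) * ((x / 2) ^ k / k !) + (x / 2) ^ (-a) * (x ^ k / k !)) :=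
          Summable.tsum_le_tsum hterm hsn hmaj.summable
      _ = _ := hmaj.tsum_eq
  -- the two pieces
  have hp1 : x * Real.exp (-x) * ((2 : ℝ) ^ (x / 2) * Real.exp (x / 2)) ≤ 1 / c := by
    have heq : x * Real.exp (-x) * ((2 : ℝ) ^ (x / 2) * Real.exp (x / 2)) =
        x * Real.exp (-(c * x)) := by
      rw [Real.rpow_def_of_pos two_pos, mul_assoc, ← Real.exp_add, ← Real.exp_add]
      congr 1
      congr 1
      rw [hc]
      ring
    rw [heq]
    -- `x e^{-cx} ≤ 1/c` from `1 + cx ≤ e^{cx}` (cf. `MoebiusDyadic.mul_exp_neg_le_inv`)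
    have hexp1 := Real.add_one_le_exp (c * x)
    rw [Real.exp_neg, ← div_eq_mul_inv, div_le_div_iff₀ (Real.exp_pos _) hcpos, one_mul]
    nlinarith
  have hp2 : x * Real.exp (-x) * ((x / 2) ^ (-a) * Real.exp x) = (2 : ℝ) ^ a * x ^ (1 - a) := by
    rw [Real.div_rpow hx0.le zero_le_two, Real.rpow_neg zero_le_two, Real.rpow_sub hx0,
      Real.rpow_one, Real.rpow_neg hx0.le, Real.exp_neg]
    have he : Real.exp x ≠ 0 := (Real.exp_pos x).ne'
    have h2a : (2 : ℝ) ^ a ≠ 0 := by positivity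
    have hxa : x ^ a ≠ 0 := by positivity
    field_simp
  have hx1a : 1 ≤ x ^ (1 - a) := Real.one_le_rpow hx (by linarith)
  -- assemble
  rw [rieszFunction_eq_exp_mul_tsum_baezDuarteCoeff, norm_mul, Real.norm_of_nonneg (by positivity),
    Real.norm_of_nonneg (by positivity : (0 : ℝ) ≤ x ^ (1 - a))]
  calc x * Real.exp (-x) * ‖∑' k : ℕ, baezDuarteCoeff k * x ^ k / (k ! : ℝ)‖
      ≤ x * Real.exp (-x) * (C * ((2 : ℝ) ^ (x / 2) * Real.exp (x / 2) +
          (x / 2) ^ (-a) * Real.exp x)) := by gcongr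
    _ = C * (x * Real.exp (-x) * ((2 : ℝ) ^ (x / 2) * Real.exp (x / 2))) +
          C * (x * Real.exp (-x) * ((x / 2) ^ (-a) * Real.exp x)) := by ring
    _ ≤ C * (1 / c) + C * ((2 : ℝ) ^ a * x ^ (1 - a)) := by rw [hp2]; gcongr
    _ ≤ C * (1 / c) * x ^ (1 - a) + C * (2 : ℝ) ^ a * x ^ (1 - a) := by
          have h1 : C * (1 / c) ≤ C * (1 / c) * x ^ (1 - a) :=
            le_mul_of_one_le_right (by positivity) hx1a
          linarith [h1]
    _ = (C * (1 / c) + C * (2 : ℝ) ^ a) * x ^ (1 - a) := by ring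

/-! ## §3 Báez-Duarte's criterion, direction "⟸" -/

/-- **Báez-Duarte's Theorem 1.1, direction "⟸" (PROVED):** if `c_k ≪ k^{−3/4+ε}` for every
`ε > 0`, then the Riemann hypothesis holds — by the transfer to Riesz's function
(`rieszFunction_isBigO_of_baezDuarteCoeff_isBigO`) and Riesz's sufficiency theorem
(`riemannHypothesis_of_rieszFunction_isBigO`). This is the right-to-left half of the named fact
`BaezDuarte2005_thm_1_1`. [cite: BaezDuarte2005, Thm. 1.1 and §2 Prop. 2.1 (sufficiency)] -/
theorem riemannHypothesis_of_baezDuarteCoeff_isBigO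
    (h : ∀ ε : ℝ, 0 < ε →
      (fun k : ℕ ↦ baezDuarteCoeff k) =O[atTop] fun k : ℕ ↦ (k : ℝ) ^ (-(3 / 4 : ℝ) + ε)) :
    RiemannHypothesis := by
  refine riemannHypothesis_of_rieszFunction_isBigO fun ε hε ↦ ?_
  -- use the hypothesis at `ε' = min ε (1/2)`, so that `a = 3/4 - ε' ∈ [1/4, 3/4)`
  set ε' : ℝ := min ε (1 / 2) with hε'
  have hε'pos : 0 < ε' := lt_min hε (by norm_num)
  have hε'le : ε' ≤ ε := min_le_left _ _
  have hε'half : ε' ≤ 1 / 2 := min_le_right _ _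
  have hO := rieszFunction_isBigO_of_baezDuarteCoeff_isBigO (a := 3 / 4 - ε') (by linarith)
    (by linarith) ((h ε' hε'pos).congr_right fun k ↦ by congr 1; ring)
  refine hO.trans (IsBigO.of_bound 1 ?_)
  filter_upwards [eventually_ge_atTop (1 : ℝ)] with x hx
  rw [one_mul, Real.norm_of_nonneg (by positivity), Real.norm_of_nonneg (by positivity)]
  exact Real.rpow_le_rpow_of_exponent_le hx (by linarith)

/-- The same in the shape of the named fact: the right-hand side of `BaezDuarte2005_thm_1_1` implies
its left-hand side. [cite: BaezDuarte2005, Thm. 1.1, sufficiency] -/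
theorem BaezDuarte2005_thm_1_1.mpr_holds :
    (∀ ε : ℝ, 0 < ε →
      (fun k : ℕ ↦ baezDuarteCoeff k) =O[atTop] fun k : ℕ ↦ (k : ℝ) ^ (-(3 / 4 : ℝ) + ε)) →
      RiemannHypothesis :=
  riemannHypothesis_of_baezDuarteCoeff_isBigO

end Literature.NumberTheory.LFunctions

end
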